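import Literature.NumberTheory.LFunctions.DedekindZetaFunctionalEquationProofs
import Literature.NumberTheory.LFunctions.UniformClassGroupPNT
import HarnessLib

/-!
# The functional equation of the class-twisted zeta functions `Σ_C a(C) ζ(C, s)`, in particular
# of the `L`-functions of class group characters

Topic `Literature/NumberTheory/LFunctions` (namespace `Literature.NumberTheory.LFunctions.NumberField`),
continuing `DedekindZetaFunctionalEquationProofs.lean` (Hecke's functional equation
`Λ_K(1 − s) = Λ_K(s)`, assembled from the class pairs `classPair`, the duality `exists_classDuality`
of the class representatives and `heckePair_Λ_spanSingleton_mul`) and `UniformClassGroupPNT.lean`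
(`classGroupLFunction K χ s = Σ_C χ(C) ζ(C, s)`).  Everything here is PROVED (two definitions with
bodies, theorems).

For ANY coefficient function `a : Cl_K → ℂ` put `Z_a(s) = Σ_C a(C) ζ(C, s)` (`classTwistedZeta`;
`ζ(C, s) = classSumCont`, the continued class partial zeta functions, Neukirch VII (5.9)) and
`Λ_a(s) = |d_K|^{s/2} Γ_ℝ(s)^{r₁} Γ_ℂ(s)^{r₂} Z_a(s)` (`completedClassTwistedZeta`, the gamma factor
`dedekindGammaFactor` of `ζ_K`).  Then (`exists_perm_completedClassTwistedZeta_one_sub`)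

  `Λ_a(1 − s) = Λ_{a ∘ σ⁻¹}(s)`  off the integers,

for a permutation `σ` of `Cl_K` independent of `a` and `s` (the duality `𝔎 ↦ [𝔡]⁻¹ 𝔎⁻¹` of
Neukirch VII (5.9)–(5.10) on the chosen representatives, `exists_classDuality`).  For `a = 1` this
is the functional equation of `ζ_K`; for `a = χ` a class group character it is the functional
equation of `L(s, χ)` (Neukirch VII (8.5)–(8.6) for `𝔪 = 1`; [ThornerZaman2019, (2.6)] with
`𝔣_χ = 1`, `a(χ) + b(χ) = n_K` realised as `r₁ + 2r₂`), with `a ∘ σ⁻¹ = χ̄(·) · χ̄([𝔡]⁻¹)` — the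
shape needed here is only that `a ∘ σ⁻¹` again has modulus `≤ 1`, which gives the convexity bound
of `L(s, χ)` uniformly in `K` exactly as for `ζ_K` (`DedekindZetaEntireConvexity.lean`).

* `classTwistedZeta`, `completedClassTwistedZeta`; `classGroupLFunction_eq_classTwistedZeta`
  (`L(s, χ) = Z_χ(s)`, definitional), `classTwistedZeta_one` (`Z_1 = ζ_K` off `s = 1`),
  `norm_classTwistedZeta_le` (`|Z_a(s)| ≤ Σ_C |ζ(C, s)|` for `|a| ≤ 1`);
* `exists_perm_completedClassTwistedZeta_one_sub` — the functional equation.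

## References

* J. Neukirch, *Algebraic Number Theory*, Springer 1999, Ch. VII (5.9)–(5.10), (8.5)–(8.6).
  [NeukirchANT1999]
* J. Thorner, A. Zaman, *A unified and improved Chebotarev density theorem*, ANT 13 (2019), §2.3
  (2.6). [ThornerZaman2019]
-/

noncomputable section

open scoped NumberField nonZeroDivisors
open NumberField NumberField.InfinitePlace NumberField.Units Complex Filter Topology Set

namespace Literature.NumberTheory.LFunctions.NumberField

variable (K : Type*) [Field K] [NumberField K]

/-- **The class-twisted zeta function** `Z_a(s) = Σ_C a(C) ζ(C, s)` of a coefficient function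
`a : Cl_K → ℂ` (`ζ(C, s) = classSumCont`, continued; for `a = χ` a class group character this is
`classGroupLFunction K χ`, `classGroupLFunction_eq_classTwistedZeta`).
[cite: NeukirchANT1999, Ch. VII (5.9)] -/
def classTwistedZeta (a : ClassGroup (𝓞 K) → ℂ) (s : ℂ) : ℂ :=
  ∑ C : ClassGroup (𝓞 K), a C * classSumCont (thetaIdeal_inv_holds K) C s

/-- **The completed class-twisted zeta function** `Λ_a(s) = |d_K|^{s/2} Γ_ℝ(s)^{r₁} Γ_ℂ(s)^{r₂} Z_a(s)`
(the gamma factor of `ζ_K`, `dedekindGammaFactor`; for a class group character of conductor `1`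
this is the completed `L`-function, Neukirch VII (8.3)–(8.5)). [cite: NeukirchANT1999, Ch. VII (8.5)] -/
def completedClassTwistedZeta (a : ClassGroup (𝓞 K) → ℂ) (s : ℂ) : ℂ :=
  dedekindGammaFactor K s * classTwistedZeta K a s

variable {K}

/-- `L(s, χ) = Z_χ(s)` (definitional). [folklore] -/
theorem classGroupLFunction_eq_classTwistedZeta (χ : ClassGroup (𝓞 K) →* ℂˣ) (s : ℂ) :
    classGroupLFunction K χ s = classTwistedZeta K (fun C ↦ (χ C : ℂ)) s := rfl

/-- `Z_1(s) = ζ_K(s)` for `s ≠ 1`. [cite: NeukirchANT1999, Ch. VII (5.11)] -/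
theorem classTwistedZeta_one {s : ℂ} (hs : s ≠ 1) :
    classTwistedZeta K (fun _ ↦ 1) s = dedekindZetaCont K s := by
  rw [dedekindZetaCont_eq_sum_classSumCont (thetaIdeal_inv_holds K) hs, classTwistedZeta]
  exact Finset.sum_congr rfl fun C _ ↦ one_mul _

/-- `|Z_a(s)| ≤ Σ_C |ζ(C, s)|` for `|a| ≤ 1`. [folklore] -/
theorem norm_classTwistedZeta_le {a : ClassGroup (𝓞 K) → ℂ} (ha : ∀ C, ‖a C‖ ≤ 1) (s : ℂ) :
    ‖classTwistedZeta K a s‖ ≤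
      ∑ C : ClassGroup (𝓞 K), ‖classSumCont (thetaIdeal_inv_holds K) C s‖ := by
  refine (norm_sum_le _ _).trans (Finset.sum_le_sum fun C _ ↦ ?_)
  rw [norm_mul]
  exact mul_le_of_le_one_left (norm_nonneg _) (ha C)

/-- `Z_a` is additive and homogeneous in `a`: `Z_{a} = Σ_C a(C) Z_{δ_C}` — in particular it is
holomorphic off `s = 1` (finite sum of `classSumCont`). [folklore] -/
theorem differentiableOn_classTwistedZeta (a : ClassGroup (𝓞 K) → ℂ) :
    DifferentiableOn ℂ (classTwistedZeta K a) {1}ᶜ := by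
  have : classTwistedZeta K a = fun s ↦
      ∑ C : ClassGroup (𝓞 K), a C * classSumCont (thetaIdeal_inv_holds K) C s := by
    funext s; rfl
  rw [this]
  exact DifferentiableOn.fun_sum fun C _ ↦
    (differentiableOn_const _).mul (differentiableOn_classSumCont (thetaIdeal_inv_holds K) C)

/-! ### The functional equation -/

/-- **Functional equation of the class-twisted zeta functions.**  There is a permutation `σ` of
the class group (the duality of `exists_classDuality`: the dual `(J_C 𝔡)⁻¹` of the representative
of `C⁻¹` is `v_C · J_{σ C}`) such that for every coefficient function `a : Cl_K → ℂ` and every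
`s ∉ ℤ`,
`Λ_a(1 − s) = Λ_{a ∘ σ⁻¹}(s)`, `Λ_a(s) = |d_K|^{s/2} Γ_ℝ(s)^{r₁} Γ_ℂ(s)^{r₂} Σ_C a(C) ζ(C, s)`.
For `a = 1`: Hecke's `Λ_K(1 − s) = Λ_K(s)` (the tree's `completedDedekindZeta_one_sub_holds`, whose
proof is followed verbatim with the weights `a(C)` carried along); for `a = χ`: the functional
equation of the class group `L`-function (Neukirch VII (8.6), `𝔪 = 1`).
[cite: NeukirchANT1999, Ch. VII (5.10), (8.6)] -/
theorem exists_perm_completedClassTwistedZeta_one_sub :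
    ∃ σ : ClassGroup (𝓞 K) ≃ ClassGroup (𝓞 K), ∀ (a : ClassGroup (𝓞 K) → ℂ) {s : ℂ},
      (∀ n : ℤ, s ≠ n) →
        completedClassTwistedZeta K a (1 - s) = completedClassTwistedZeta K (a ∘ σ.symm) s := by
  have hinv := thetaIdeal_inv_holds K
  obtain ⟨σ, v, hσv⟩ := exists_classDuality (K := K)
  refine ⟨σ, fun a s hs ↦ ?_⟩
  have hsZ : ∀ w : ℂ, (∀ n : ℤ, w ≠ n) → w ≠ 0 ∧ w ≠ 1 := fun w hw ↦
    ⟨by simpa using hw 0, by simpa using hw 1⟩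
  have hs' : ∀ n : ℤ, 1 - s ≠ n := fun n h ↦
    hs (1 - n) (by rw [← sub_sub_cancel 1 s, h]; push_cast; ring)
  obtain ⟨hs0, hs1⟩ := hsZ s hs
  -- abbreviations
  set d : ℂ := ((discr K).natAbs : ℂ) with hd
  set N : ClassGroup (𝓞 K) → ℂ := fun C ↦ (Ideal.absNorm (classRep K C : Ideal (𝓞 K)) : ℂ) with hN
  set L : ClassGroup (𝓞 K) → ℂ → ℂ := fun C z ↦ (classPair hinv C).Λ z with hL
  have hJ0 : ∀ C : ClassGroup (𝓞 K), (((classRep K C : (Ideal (𝓞 K))⁰) : Ideal (𝓞 K)) :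
      FractionalIdeal (𝓞 K)⁰ K) ≠ 0 := fun C ↦ coeIdeal_ne_zero_of_mem_nonZeroDivisors (classRep K C)
  -- Step 1: `Λ_b(w) = 2^{r₂} c⁻¹ w⁻¹ ∑_C b(C) d^{w/2} N_C^w Λ_C(w/2)` off the integers
  have hΛK : ∀ (b : ClassGroup (𝓞 K) → ℂ) (w : ℂ), (∀ n : ℤ, w ≠ n) →
      completedClassTwistedZeta K b w =
        2 ^ nrComplexPlaces K * ((heckeCst K : ℂ))⁻¹ * ((torsionOrder K : ℂ))⁻¹ *
          ∑ C, b C * (d ^ (w / 2) * N C ^ w * L C (w / 2)) := by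
    intro b w hw
    obtain ⟨hw0, hw1⟩ := hsZ w hw
    rw [completedClassTwistedZeta, classTwistedZeta, dedekindGammaFactor_eq, Finset.mul_sum,
      Finset.mul_sum]
    refine Finset.sum_congr rfl fun C _ ↦ ?_
    have hA := gammaFactorC_half_ne_zero (K := K) hw
    rw [classSumCont_eq_mul_Λ hinv C hw0]
    simp only [hd, hN, hL, classFrontFactor]
    field_simp
  -- Step 2: the functional equation of each class, moved to the representative of `σ C`
  have hFE : ∀ C, L C ((1 - s) / 2) = (classPair hinv C).ε *
      (((|(Algebra.norm ℚ (v C) : ℚ)| : ℝ) : ℂ) ^ (-s) * L (σ C) (s / 2)) := by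
    intro C
    have h1 := (classPair hinv C).functional_equation (s / 2)
    have hk : ((classPair hinv C).k : ℂ) - s / 2 = (1 - s) / 2 := by
      show ((1 / 2 : ℝ) : ℂ) - s / 2 = (1 - s) / 2; push_cast; ring
    rw [hk, smul_eq_mul] at h1
    simp only [hL]
    rw [h1]
    congr 1
    have h2 : (classPair hinv C).symm = heckePair K hinv (FractionalIdeal.dual ℤ ℚ _)
        (FractionalIdeal.dual_ne_zero ℤ ℚ (hJ0 C)) := heckePair_symm hinv _ (hJ0 C)
    have hxI : FractionalIdeal.spanSingleton (𝓞 K)⁰ (v C) *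
        (((classRep K (σ C) : (Ideal (𝓞 K))⁰) : Ideal (𝓞 K)) : FractionalIdeal (𝓞 K)⁰ K) ≠ 0 :=
      mul_ne_zero (FractionalIdeal.spanSingleton_ne_zero_iff.mpr (hσv C).1) (hJ0 (σ C))
    have hz0 : s / 2 ≠ 0 := div_ne_zero hs0 two_ne_zero
    have hzk : s / 2 ≠ ((1 / 2 : ℝ) : ℂ) := by
      intro h; apply hs1
      have := congr_arg (fun z : ℂ ↦ 2 * z) h
      push_cast at this
      linear_combination this
    rw [h2, heckePair_congr hinv (hσv C).2.1 _ hxI,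
      heckePair_Λ_spanSingleton_mul hinv (hσv C).1 _ (hJ0 (σ C)) hxI hz0 hzk,
      show -(2 * (s / 2)) = -s by ring]
    rfl
  -- Step 3: the coefficients match after re-indexing
  have hcoef : ∀ C, d ^ ((1 - s) / 2) * N C ^ (1 - s) * ((classPair hinv C).ε *
      (((|(Algebra.norm ℚ (v C) : ℚ)| : ℝ) : ℂ) ^ (-s))) = d ^ (s / 2) * N (σ C) ^ s := by
    intro C
    have hnC : (0 : ℝ) < Ideal.absNorm (classRep K C : Ideal (𝓞 K)) :=
      Nat.cast_pos.mpr (Ideal.absNorm_pos_of_nonZeroDivisors (classRep K C))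
    have hnD : (0 : ℝ) < Ideal.absNorm (classRep K (σ C) : Ideal (𝓞 K)) :=
      Nat.cast_pos.mpr (Ideal.absNorm_pos_of_nonZeroDivisors (classRep K (σ C)))
    have hdn : (0 : ℝ) < (discr K).natAbs := Nat.cast_pos.mpr (Int.natAbs_pos.mpr (discr_ne_zero K))
    have hav : (0 : ℝ) < |((Algebra.norm ℚ (v C) : ℚ) : ℝ)| := by
      have : (Algebra.norm ℚ (v C) : ℚ) ≠ 0 := Algebra.norm_ne_zero_iff.mpr (hσv C).1
      positivity
    have hprod : (Ideal.absNorm (classRep K (σ C) : Ideal (𝓞 K)) : ℝ) * (discr K).natAbs *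
        Ideal.absNorm (classRep K C : Ideal (𝓞 K)) * |((Algebra.norm ℚ (v C) : ℚ) : ℝ)| = 1 := by
      have := congr_arg (Rat.cast : ℚ → ℝ) (hσv C).2.2
      push_cast at this
      exact this
    have hlog : Real.log (Ideal.absNorm (classRep K (σ C) : Ideal (𝓞 K))) +
        Real.log ((discr K).natAbs) + Real.log (Ideal.absNorm (classRep K C : Ideal (𝓞 K))) +
        Real.log |((Algebra.norm ℚ (v C) : ℚ) : ℝ)| = 0 := by
      have := congr_arg Real.log hprod
      rwa [Real.log_mul (by positivity) hav.ne', Real.log_mul (by positivity) hnC.ne',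
        Real.log_mul hnD.ne' hdn.ne', Real.log_one] at this
    have hlogC := congr_arg (fun x : ℝ ↦ (x : ℂ)) hlog
    simp only [Complex.ofReal_add, Complex.ofReal_zero] at hlogC
    have hd' : d = (((discr K).natAbs : ℝ) : ℂ) := by rw [hd, Complex.ofReal_natCast]
    have hNC : N C = ((Ideal.absNorm (classRep K C : Ideal (𝓞 K)) : ℝ) : ℂ) := by
      rw [hN]; simp only [Complex.ofReal_natCast]
    have hND : N (σ C) = ((Ideal.absNorm (classRep K (σ C) : Ideal (𝓞 K)) : ℝ) : ℂ) := by
      rw [hN]; simp only [Complex.ofReal_natCast]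
    rw [hd', hNC, hND, ofReal_cpow_eq_exp hdn, ofReal_cpow_eq_exp hdn, ofReal_cpow_eq_exp hnC,
      ofReal_cpow_eq_exp hnD, ofReal_cpow_eq_exp hav, classPair_ε_eq_exp hinv C,
      ← Complex.exp_add, ← Complex.exp_add, ← Complex.exp_add, ← Complex.exp_add]
    congr 1
    linear_combination (-s) * hlogC
  -- Step 4: assemble, re-indexing the classes by `σ`
  rw [hΛK a (1 - s) hs', hΛK (a ∘ σ.symm) s hs]
  congr 1
  calc ∑ C, a C * (d ^ ((1 - s) / 2) * N C ^ (1 - s) * L C ((1 - s) / 2))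
      = ∑ C, (a ∘ σ.symm) (σ C) * (d ^ (s / 2) * N (σ C) ^ s * L (σ C) (s / 2)) := by
        refine Finset.sum_congr rfl fun C _ ↦ ?_
        rw [Function.comp_apply, σ.symm_apply_apply, hFE C, ← hcoef C]; ring
    _ = ∑ C, (a ∘ σ.symm) C * (d ^ (s / 2) * N C ^ s * L C (s / 2)) :=
        σ.sum_comp (fun C ↦ (a ∘ σ.symm) C * (d ^ (s / 2) * N C ^ s * L C (s / 2)))

/-- **Functional equation of the `L`-function of a class group character**, conductor `1`:
`Λ(1 − s, χ) = Λ(s, χ')` off the integers, with `Λ(s, χ) = |d_K|^{s/2} Γ_ℝ(s)^{r₁} Γ_ℂ(s)^{r₂} L(s, χ)`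
and `χ' = χ ∘ σ⁻¹` for the duality permutation `σ` of the classes (a function of modulus `1` on
`Cl_K`; classically `χ' = χ̄ · χ̄([𝔡])`). [cite: NeukirchANT1999, Ch. VII (8.6)] -/
theorem exists_perm_completedClassGroupLFunction_one_sub :
    ∃ σ : ClassGroup (𝓞 K) ≃ ClassGroup (𝓞 K), ∀ (χ : ClassGroup (𝓞 K) →* ℂˣ) {s : ℂ},
      (∀ n : ℤ, s ≠ n) →
        dedekindGammaFactor K (1 - s) * classGroupLFunction K χ (1 - s) =
          dedekindGammaFactor K s * classTwistedZeta K (fun C ↦ (χ (σ.symm C) : ℂ)) s := by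
  obtain ⟨σ, hσ⟩ := exists_perm_completedClassTwistedZeta_one_sub (K := K)
  refine ⟨σ, fun χ s hs ↦ ?_⟩
  have h := hσ (fun C ↦ (χ C : ℂ)) hs
  simp only [completedClassTwistedZeta] at h
  exact h

end Literature.NumberTheory.LFunctions.NumberField

end
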